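import Summits.BirchSwinnertonDyer.BirchSwinnertonDyer.Theorems.CyclotomicUntwistGammaDivisibility
import HarnessLib

/-!
# The first Mahler coefficient under a one-sided main-conjecture shape: `c₁(w ⋆ μ) = c₀(w)·c₁(μ)` when
# `c₀(μ) = 0`, hence `‖c₁(char)‖ ≤ 3^{-e}‖c₁(𝓛)‖` (LOWER/Wan) and `3^{-e}‖c₁(𝓛)‖ ≤ ‖c₁(char)‖`
# (UPPER/Kato) with NO order-of-vanishing hypothesis (route `CyclotomicUntwist`, cruxes K1/K2)

Cell `pub/bsd-wall` (D-0145 line `route-BirchSwinnertonDyer-CyclotomicUntwist`), seat `bsd-line-cycu-p1`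
(prover seat 1/3), helper toward crux K1 `PSRankOneLowerHalfAtThree` (stmt-BirchSwinnertonDyer-21580;
mirror use K2, stmt-…-21581). THEOREMS ONLY (no definition, no named fact, no `sorry`). BSD is not proved
by this file and no crux of the route is proved by it; the main-conjecture shapes are HYPOTHESES written
as explicit convolution identities (`char = 3^e·(w ⋆ 𝓛)`, resp. `3^e·𝓛 = w ⋆ char`, `w ∈ Λ_𝓞` additive).

WHY. The rank-one readings GZ₃ (`c₁(𝓛) = κ·q·Reg_ψ`) and READ are statements about the FIRST Mahler
coefficient `c₁ = gammaMahlerCoeff · 1` (the `T`-coefficient of the Amice transform, `𝓛′(𝟙)`), not about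
the leading coefficient; at that level the transfer through a one-sided IMC₃ needs only the vanishing of
the constant term on the dividing side (`c₀(𝓛) = 0`, i.e. `L(E,1) = 0` interpolated — tree theorem
`CyclotomicUntwistValueAtOne.vanishing_at_one_of_analyticRank_eq_one`, cycu-p2; resp. `c₀(char) = 0`),
and NO statement about orders of vanishing or exactness (those were needed in
`CyclotomicUntwistGammaDivisibility` for the LEADING coefficient). Content:
* `gammaMahlerCoeff_one_gammaConv` (general `p`): `c₁(w ⋆ μ) = c₀(w)·c₁(μ) + c₁(w)·c₀(μ)`, so
  `c₁(w ⋆ μ) = c₀(w)·c₁(μ)` when `c₀(μ) = 0`, with `‖c₀(w)‖ ≤ 1` for `w ∈ Λ_𝓞`;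
* `p = 3`, `D : PSFiniteSlopeSelmerData W η α`, `𝓛` additive of order `≤ ½`:
  `mahlerCoeff_lower_of_eq_smul_gammaConv` (LOWER shape + `c₀(𝓛) = 0` ⇒ `c₀(char) = 0`,
  `c₁(char) = 3^e·c₀(w)·c₁(𝓛)`, `‖c₁(char)‖ ≤ 3^{-e}‖c₁(𝓛)‖`, and `c₁(char) ≠ 0 → c₁(𝓛) ≠ 0`);
  `mahlerCoeff_upper_of_smul_eq_gammaConv` (UPPER shape + `c₀(char) = 0` ⇒ `c₀(𝓛) = 0`,
  `3^e·c₁(𝓛) = c₀(w)·c₁(char)`, `3^{-e}‖c₁(𝓛)‖ ≤ ‖c₁(char)‖`, and `c₁(𝓛) ≠ 0 → c₁(char) ≠ 0`).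
Here `c_k(char) = gammaMahlerCoeff 3 D.charElt k`.

References: [cite: Benois2014, §0.4 (ii), Remarks 1 and 4] · [cite: PerrinRiou1993AIF, Introduction]
· [cite: MazurTateTeitelbaum1986Invent, §I.13] · [cite: Bellaiche2021, §6.3.5].
-/

noncomputable section

open Filter Topology Finset
open Literature.NumberTheory.EllipticCurves Literature.NumberTheory.IwasawaTheory
open Summit.BirchSwinnertonDyer.BirchSwinnertonDyer.Theorems.PSGammaConvolution
open Summit.BirchSwinnertonDyer.BirchSwinnertonDyer.Theorems.PSGammaLeadingTerm
open Summit.BirchSwinnertonDyer.BirchSwinnertonDyer.Theorems.PSGammaDivisibility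

-- single-conjunct summit: `Summit.BirchSwinnertonDyer.BirchSwinnertonDyer.…` repeats the name by design
set_option linter.dupNamespace false

namespace Summit.BirchSwinnertonDyer.BirchSwinnertonDyer.Theorems.PSGammaFirstCoefficient

variable {p : ℕ} [Fact p.Prime]

/-! ### §1 The `T`-coefficient of a product -/

/-- **`c₁(w ⋆ μ) = c₀(w)·c₁(μ) + c₁(w)·c₀(μ)`** for `w ∈ Λ_𝓞` additive and `μ` additive of order
`ν ∈ [0,1)` (the `T`-coefficient of `A(w)·A(μ)`). [cite: MazurTateTeitelbaum1986Invent, §I.13] [cite: Bellaiche2021, §6.3.5] -/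
theorem gammaMahlerCoeff_one_gammaConv {ν : ℝ} {w μ : (n : ℕ) → ZMod (p ^ n) → ℂ_[p]}
    (hw : IsGammaDistribution p w) (hw' : IsIwasawaIntegral p w) (hμ : IsGammaDistribution p μ)
    (hμ' : HasGrowthOrder p ν μ) (hν : 0 ≤ ν) (hν1 : ν < 1) :
    gammaMahlerCoeff p (gammaConv p w μ) 1 =
      gammaMahlerCoeff p w 0 * gammaMahlerCoeff p μ 1 + gammaMahlerCoeff p w 1 * gammaMahlerCoeff p μ 0 := by
  rw [gammaMahlerCoeff_gammaConv hw hμ hw'.hasGrowthOrder_zero hμ' le_rfl hν (by simpa using hν1) 1,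
    Finset.Nat.antidiagonal_succ, Finset.sum_cons, Finset.Nat.antidiagonal_zero, Finset.map_singleton,
    Finset.sum_singleton]
  rfl

/-- **`c₁(w ⋆ μ) = c₀(w)·c₁(μ)` when `c₀(μ) = 0`.** [cite: MazurTateTeitelbaum1986Invent, §I.13] -/
theorem gammaMahlerCoeff_one_gammaConv_of_coeff_zero_eq_zero {ν : ℝ} {w μ : (n : ℕ) → ZMod (p ^ n) → ℂ_[p]}
    (hw : IsGammaDistribution p w) (hw' : IsIwasawaIntegral p w) (hμ : IsGammaDistribution p μ)
    (hμ' : HasGrowthOrder p ν μ) (hν : 0 ≤ ν) (hν1 : ν < 1) (h0 : gammaMahlerCoeff p μ 0 = 0) :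
    gammaMahlerCoeff p (gammaConv p w μ) 1 = gammaMahlerCoeff p w 0 * gammaMahlerCoeff p μ 1 := by
  rw [gammaMahlerCoeff_one_gammaConv hw hw' hμ hμ' hν hν1, h0, mul_zero, add_zero]

/-- `c₀(w ⋆ μ) = c₀(w)·c₀(μ)`; in particular it vanishes when `c₀(μ)` does.
[cite: MazurTateTeitelbaum1986Invent, §I.13] -/
theorem gammaMahlerCoeff_zero_gammaConv {ν : ℝ} {w μ : (n : ℕ) → ZMod (p ^ n) → ℂ_[p]}
    (hw : IsGammaDistribution p w) (hw' : IsIwasawaIntegral p w) (hμ : IsGammaDistribution p μ)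
    (hμ' : HasGrowthOrder p ν μ) (hν : 0 ≤ ν) (hν1 : ν < 1) :
    gammaMahlerCoeff p (gammaConv p w μ) 0 = gammaMahlerCoeff p w 0 * gammaMahlerCoeff p μ 0 := by
  rw [gammaMahlerCoeff_gammaConv hw hμ hw'.hasGrowthOrder_zero hμ' le_rfl hν (by simpa using hν1) 0,
    Finset.Nat.antidiagonal_zero, Finset.sum_singleton]

/-- **`‖c₁(w ⋆ μ)‖ ≤ ‖c₁(μ)‖` when `c₀(μ) = 0`** (`‖c₀(w)‖ ≤ 1` for `w ∈ Λ_𝓞`).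
[cite: Benois2014, §0.4 Remark 1] [cite: Bellaiche2021, §6.3.5] -/
theorem norm_gammaMahlerCoeff_one_gammaConv_le {ν : ℝ} {w μ : (n : ℕ) → ZMod (p ^ n) → ℂ_[p]}
    (hw : IsGammaDistribution p w) (hw' : IsIwasawaIntegral p w) (hμ : IsGammaDistribution p μ)
    (hμ' : HasGrowthOrder p ν μ) (hν : 0 ≤ ν) (hν1 : ν < 1) (h0 : gammaMahlerCoeff p μ 0 = 0) :
    ‖gammaMahlerCoeff p (gammaConv p w μ) 1‖ ≤ ‖gammaMahlerCoeff p μ 1‖ := by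
  rw [gammaMahlerCoeff_one_gammaConv_of_coeff_zero_eq_zero hw hw' hμ hμ' hν hν1 h0, norm_mul]
  exact mul_le_of_le_one_left (norm_nonneg _) (norm_gammaMahlerCoeff_le_one hw hw' 0)

/-! ### §2 `p = 3`: first-coefficient transfers for a datum `D : PSFiniteSlopeSelmerData W η α` -/

section Three

variable {W : WeierstrassCurve ℚ} {η : DirichletCharacter ℂ_[3] (3 ^ 2)} {α : ℂ_[3]}
  (D : PSFiniteSlopeSelmerData W η α) {𝓛 w : (n : ℕ) → ZMod (3 ^ n) → ℂ_[3]} {e : ℤ}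

/-- **LOWER-HALF SHAPE at the first coefficient.** If `char = 3^e·(w ⋆ 𝓛)` (`𝓛 ∣ char` in `𝓗`, the
`⊇`/Wan direction), `w ∈ Λ_𝓞` additive, `𝓛` additive of order `≤ ½` with `𝓛(𝟙) = c₀(𝓛) = 0`, then
`c₀(char) = 0`, `c₁(char) = 3^e·c₀(w)·c₁(𝓛)`, `‖c₁(char)‖ ≤ 3^{-e}·‖c₁(𝓛)‖`, and `c₁(char) ≠ 0 → c₁(𝓛) ≠ 0`.
[cite: Benois2014, §0.4 (ii) and Remark 1] [cite: PerrinRiou1993AIF, Introduction] -/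
theorem mahlerCoeff_lower_of_eq_smul_gammaConv
    (hw : IsGammaDistribution 3 w) (hw' : IsIwasawaIntegral 3 w) (h𝓛 : IsGammaDistribution 3 𝓛)
    (h𝓛' : HasGrowthOrder 3 (1 / 2) 𝓛)
    (hchar : ∀ (n : ℕ) (s : ZMod (3 ^ n)), D.charElt n s = (3 : ℂ_[3]) ^ e * gammaConv 3 w 𝓛 n s)
    (h0 : gammaMahlerCoeff 3 𝓛 0 = 0) :
    gammaMahlerCoeff 3 D.charElt 0 = 0 ∧
      gammaMahlerCoeff 3 D.charElt 1 = (3 : ℂ_[3]) ^ e * gammaMahlerCoeff 3 w 0 * gammaMahlerCoeff 3 𝓛 1 ∧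
      ‖gammaMahlerCoeff 3 D.charElt 1‖ ≤ (3 : ℝ) ^ (-e) * ‖gammaMahlerCoeff 3 𝓛 1‖ ∧
      (gammaMahlerCoeff 3 D.charElt 1 ≠ 0 → gammaMahlerCoeff 3 𝓛 1 ≠ 0) := by
  have hD : D.charElt = fun n s ↦ (3 : ℂ_[3]) ^ e * gammaConv 3 w 𝓛 n s :=
    funext fun n ↦ funext fun s ↦ hchar n s
  have hX : IsGammaDistribution 3 (gammaConv 3 w 𝓛) := isGammaDistribution_gammaConv hw h𝓛
  have hX' : HasGrowthOrder 3 (0 + 1 / 2) (gammaConv 3 w 𝓛) :=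
    hasGrowthOrder_gammaConv hw'.hasGrowthOrder_zero h𝓛'
  have norm_three_zpow : ‖(3 : ℂ_[3]) ^ e‖ = (3 : ℝ) ^ (-e) := by
    -- tree: `CyclotomicUntwistFiniteSlopeKatoTyped.norm_three_zpow` (cycu-p3); inlined to keep imports light
    have : ‖((3 : ℕ) : ℂ_[3])‖ = ((3 : ℕ) : ℝ)⁻¹ := by
      rw [← map_natCast (algebraMap ℚ_[3] ℂ_[3]) 3, norm_algebraMap', Padic.norm_p]
    rw [norm_zpow, show (3 : ℂ_[3]) = ((3 : ℕ) : ℂ_[3]) by norm_cast, this]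
    push_cast
    rw [inv_zpow']
  have hc1 : gammaMahlerCoeff 3 D.charElt 1 =
      (3 : ℂ_[3]) ^ e * gammaMahlerCoeff 3 w 0 * gammaMahlerCoeff 3 𝓛 1 := by
    rw [hD, gammaMahlerCoeff_smul _ hX hX' (by norm_num),
      gammaMahlerCoeff_one_gammaConv_of_coeff_zero_eq_zero hw hw' h𝓛 h𝓛' (by norm_num) (by norm_num) h0,
      mul_assoc]
  refine ⟨?_, hc1, ?_, ?_⟩
  · rw [hD, gammaMahlerCoeff_smul _ hX hX' (by norm_num),
      gammaMahlerCoeff_zero_gammaConv hw hw' h𝓛 h𝓛' (by norm_num) (by norm_num), h0, mul_zero, mul_zero]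
  · rw [hc1, norm_mul, norm_mul, norm_three_zpow, mul_assoc]
    exact mul_le_mul_of_nonneg_left
      (mul_le_of_le_one_left (norm_nonneg _) (norm_gammaMahlerCoeff_le_one hw hw' 0))
      (zpow_nonneg (by norm_num) _)
  · intro h h1
    exact h (by rw [hc1, h1, mul_zero])

/-- **UPPER-HALF SHAPE at the first coefficient.** If `3^e·𝓛 = w ⋆ char` (`char ∣ 𝓛` in `𝓗`, the
`⊆`/Kato direction), `w ∈ Λ_𝓞` additive, `𝓛` additive of order `≤ ½`, and `c₀(char) = 0`, then
`c₀(𝓛) = 0`, `3^e·c₁(𝓛) = c₀(w)·c₁(char)`, `3^{-e}·‖c₁(𝓛)‖ ≤ ‖c₁(char)‖`, and `c₁(𝓛) ≠ 0 → c₁(char) ≠ 0`.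
[cite: Benois2014, §0.4 Remark 4] [cite: PerrinRiou1993AIF, Introduction] -/
theorem mahlerCoeff_upper_of_smul_eq_gammaConv
    (hw : IsGammaDistribution 3 w) (hw' : IsIwasawaIntegral 3 w) (h𝓛 : IsGammaDistribution 3 𝓛)
    (h𝓛' : HasGrowthOrder 3 (1 / 2) 𝓛)
    (hdiv : ∀ (n : ℕ) (s : ZMod (3 ^ n)), (3 : ℂ_[3]) ^ e * 𝓛 n s = gammaConv 3 w D.charElt n s)
    (h0 : gammaMahlerCoeff 3 D.charElt 0 = 0) :
    gammaMahlerCoeff 3 𝓛 0 = 0 ∧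
      (3 : ℂ_[3]) ^ e * gammaMahlerCoeff 3 𝓛 1 = gammaMahlerCoeff 3 w 0 * gammaMahlerCoeff 3 D.charElt 1 ∧
      (3 : ℝ) ^ (-e) * ‖gammaMahlerCoeff 3 𝓛 1‖ ≤ ‖gammaMahlerCoeff 3 D.charElt 1‖ ∧
      (gammaMahlerCoeff 3 𝓛 1 ≠ 0 → gammaMahlerCoeff 3 D.charElt 1 ≠ 0) := by
  have hEq : (fun n s ↦ (3 : ℂ_[3]) ^ e * 𝓛 n s) = gammaConv 3 w D.charElt :=
    funext fun n ↦ funext fun s ↦ hdiv n s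
  have norm_three_zpow : ‖(3 : ℂ_[3]) ^ e‖ = (3 : ℝ) ^ (-e) := by
    -- tree: `CyclotomicUntwistFiniteSlopeKatoTyped.norm_three_zpow` (cycu-p3); inlined to keep imports light
    have : ‖((3 : ℕ) : ℂ_[3])‖ = ((3 : ℕ) : ℝ)⁻¹ := by
      rw [← map_natCast (algebraMap ℚ_[3] ℂ_[3]) 3, norm_algebraMap', Padic.norm_p]
    rw [norm_zpow, show (3 : ℂ_[3]) = ((3 : ℕ) : ℂ_[3]) by norm_cast, this]
    push_cast
    rw [inv_zpow']
  have hc : ((3 : ℂ_[3]) ^ e) ≠ 0 := zpow_ne_zero _ (by norm_num)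
  have hc0 : (3 : ℂ_[3]) ^ e * gammaMahlerCoeff 3 𝓛 0 = 0 := by
    rw [← gammaMahlerCoeff_smul _ h𝓛 h𝓛' (by norm_num), hEq,
      gammaMahlerCoeff_zero_gammaConv hw hw' D.isGammaDistribution_charElt D.hasGrowthOrder_charElt
        (by norm_num) (by norm_num), h0, mul_zero]
  have hc1 : (3 : ℂ_[3]) ^ e * gammaMahlerCoeff 3 𝓛 1 = gammaMahlerCoeff 3 w 0 * gammaMahlerCoeff 3 D.charElt 1 := by
    rw [← gammaMahlerCoeff_smul _ h𝓛 h𝓛' (by norm_num), hEq,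
      gammaMahlerCoeff_one_gammaConv_of_coeff_zero_eq_zero hw hw' D.isGammaDistribution_charElt
        D.hasGrowthOrder_charElt (by norm_num) (by norm_num) h0]
  refine ⟨(mul_eq_zero.mp hc0).resolve_left hc, hc1, ?_, ?_⟩
  · rw [← norm_three_zpow, ← norm_mul, hc1, norm_mul]
    exact mul_le_of_le_one_left (norm_nonneg _) (norm_gammaMahlerCoeff_le_one hw hw' 0)
  · intro h1 h
    apply h1
    have : (3 : ℂ_[3]) ^ e * gammaMahlerCoeff 3 𝓛 1 = 0 := by rw [hc1, h, mul_zero]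
    exact (mul_eq_zero.mp this).resolve_left hc

end Three

end Summit.BirchSwinnertonDyer.BirchSwinnertonDyer.Theorems.PSGammaFirstCoefficient

end
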